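import Mathlib
import Summits.Ventures.PercRepro2.SwOutArmThm
import Summits.Ventures.PercRepro2.DoublyTypedRowGen

/-!
# THE ARM PRINCIPLE FOR THE GENERAL DOUBLY TYPED ROW (blind cell PercRepro2, night-4 g30,
2026-08-28; proofs/NIGHT4-G30.md §9)

Night-4 g7's general doubly typed class `gTypedQ ends l h 𝓤 𝓓 𝓓″ X 𝓤′ = {h ∉ H_l, C_R(l) ∈ 𝓤,
C_B(l) ∈ 𝓓, C_R(h) ∈ 𝓓″, X ∩ H_h = ∅, C_B(h) ∈ 𝓤′}` (`𝓤, 𝓤′` up-sets, `𝓓, 𝓓″` down-sets, `X` any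
vertex set) is exactly the family of conditions an ARM FLIP respects: flipping red arms to blue
enlarges `C_R(l)`, shrinks `C_B(l)`, shrinks `C_R(h)` (the arms leave it), keeps the hull of `h`,
and enlarges `C_B(h)` (the arms join it) — `flip_mem_gTypedQ_of_armClosed_red`.  So g10's arm
principle holds on the general doubly typed side verbatim: `card_orbit_le_g`, `card_coreFree_le_g`,
`rigidOK_g_of_coreFree`, `rigidOK_g_of_outEdges'` (a core is excluded at the vertices forced into
`C_R(l)` by `𝓤`, forced out of `C_R(h)` by `𝓓″`, or in `X`), and on the whole graph
**`gTypedSwAll_of_outEdges`**: the general doubly typed row — «the candidate inductive statement of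
the whole reduction programme» (NIGHT4-G7.md §9) — on every graph whose vertices other than `l, h`
are joined to `l`, isolated, or exempt, for every admissible choice of the five conditions.
-/

namespace Summit.Ventures.PercRepro2

namespace LocRows

open Hull

variable {V : Type*} {E : Type*} [Fintype E] [DecidableEq E]

open scoped Classical

variable {ends : E → Sym2 V}

section Side

variable (ends)

/-- `gTypedQ ∩ outClass`. -/
noncomputable def gOutSide (l h : V) (𝓤 𝓓 𝓓'' : Set (Set V)) (X : Set V) (𝓤' : Set (Set V))
    (U : Set V) (ξ : Config E) : Finset (Config E) :=
  gTypedQ ends l h 𝓤 𝓓 𝓓'' X 𝓤' ∩ outClass ends U h ξ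

/-- The core-free part of the general doubly typed side of a class. -/
noncomputable def gCoreFreePart (l h : V) (𝓤 𝓓 𝓓'' : Set (Set V)) (X : Set V)
    (𝓤' : Set (Set V)) (U : Set V) (ξ : Config E) : Finset (Config E) :=
  (gOutSide ends l h 𝓤 𝓓 𝓓'' X 𝓤' U ξ).filter fun ζ => CoreFree ends ζ h

variable {ends}

/-- Membership in the general doubly typed class. -/
lemma mem_gTypedQ {l h : V} {𝓤 𝓓 𝓓'' : Set (Set V)} {X : Set V} {𝓤' : Set (Set V)}
    {ζ : Config E} :
    ζ ∈ gTypedQ ends l h 𝓤 𝓓 𝓓'' X 𝓤' ↔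
      h ∉ hull ends ζ l ∧ cluster ends ζ l ∈ 𝓤 ∧ cluster ends (blue ζ) l ∈ 𝓓 ∧
        cluster ends ζ h ∈ 𝓓'' ∧ (∀ x ∈ X, x ∉ hull ends ζ h) ∧ cluster ends (blue ζ) h ∈ 𝓤' := by
  simp only [gTypedQ, Finset.mem_filter, Finset.mem_univ, true_and]

/-- Membership in `gOutSide`. -/
lemma mem_gOutSide {l h : V} {𝓤 𝓓 𝓓'' : Set (Set V)} {X : Set V} {𝓤' : Set (Set V)}
    {U : Set V} {ξ ζ : Config E} :
    ζ ∈ gOutSide ends l h 𝓤 𝓓 𝓓'' X 𝓤' U ξ ↔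
      ζ ∈ gTypedQ ends l h 𝓤 𝓓 𝓓'' X 𝓤' ∧ ζ ∈ outClass ends U h ξ := by
  simp only [gOutSide, Finset.mem_inter]

/-- On the general doubly typed side the hull of `h` avoids `l`. -/
lemma l_notMem_hull_of_mem_gTypedQ {l h : V} {𝓤 𝓓 𝓓'' : Set (Set V)} {X : Set V}
    {𝓤' : Set (Set V)} {ζ : Config E} (hζ : ζ ∈ gTypedQ ends l h 𝓤 𝓓 𝓓'' X 𝓤') :
    l ∉ hull ends ζ h := by
  rw [mem_gTypedQ] at hζ
  intro hl
  apply hζ.1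
  rcases hl with hl | hl
  · exact Or.inl (conn_symm hl)
  · exact Or.inr (conn_symm hl)

end Side

section Flip

variable {ζ : Config E} {h : V} {P : Set V}

/-- **Flipping red arms to blue keeps the general doubly typed side**: `C_R(l)` grows, `C_B(l)`
shrinks, `C_R(h)` loses the arms, the hull of `h` is unchanged, `C_B(h)` gains the arms. -/
theorem flip_mem_gTypedQ_of_armClosed_red {U : Set V} {l : V} {𝓤 𝓓 𝓓'' : Set (Set V)} {X : Set V}
    {𝓤' : Set (Set V)} (h𝓤 : IsUpperSet 𝓤) (h𝓓 : IsLowerSet 𝓓) (h𝓓'' : IsLowerSet 𝓓'')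
    (h𝓤' : IsUpperSet 𝓤') (hc : CoreFree ends ζ h) (hP : ArmClosed ends ζ h P)
    (hPT : P ⊆ cluster ends ζ h) (hUP : P ⊆ U) (hl : l ∉ U)
    (hQ : ζ ∈ gTypedQ ends l h 𝓤 𝓓 𝓓'' X 𝓤') : flip ends P ζ ∈ gTypedQ ends l h 𝓤 𝓓 𝓓'' X 𝓤' := by
  have hlP : l ∉ P := fun h' => hl (hUP h')
  rw [mem_gTypedQ] at hQ ⊢
  obtain ⟨hh, hA, hB, hRh, hX, hBh⟩ := hQ
  have hhA : h ∉ cluster ends ζ l := fun h' => hh (Or.inl h')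
  have hhB : h ∉ cluster ends (blue ζ) l := fun h' => hh (Or.inr h')
  have hPB : ∀ x ∈ P, x ∉ cluster ends (blue ζ) h := by
    intro x hxP hxB
    have hxh : x = h := hc x (hPT hxP) hxB
    exact (hP.subset x hxP).2 hxh
  refine ⟨?_, h𝓤 (cluster_l_subset_flip_of_armClosed_red hPT hlP hhA) hA,
    h𝓓 (cluster_blue_flip_subset_of_armClosed_red hc hP hPT hlP hhB) hB, ?_, ?_, ?_⟩
  · rintro (h1 | h1)
    · exact h_notMem_cluster_flip_of_armClosed_red hc hP hPT hhA h1
    · exact hhB (cluster_blue_flip_subset_of_armClosed_red hc hP hPT hlP hhB h1)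
  · refine h𝓓'' ?_ hRh
    rw [cluster_flip_of_armClosed hc hP]
    rintro x (⟨hx, -⟩ | ⟨hxP, hxB⟩)
    · exact hx
    · exact absurd hxB (hPB x hxP)
  · intro x hxX
    rw [hull_flip_of_armClosed hc hP]
    exact hX x hxX
  · refine h𝓤' ?_ hBh
    rw [cluster_blue_flip_of_armClosed hc hP]
    intro x hx
    exact Or.inl ⟨hx, fun hxP => hPB x hxP hx⟩

end Flip

section OrbitCube

variable {ζ : Config E} {h : V} (hc : CoreFree ends ζ h)
include hc

/-- **The general doubly typed conditioning pulls back to a lower set of the orbit cube.** -/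
theorem orbitReal_mem_gTypedQ_of_le {U : Set V} {ξ : Config E} {l : V} {𝓤 𝓓 𝓓'' : Set (Set V)}
    {X : Set V} {𝓤' : Set (Set V)} (h𝓤 : IsUpperSet 𝓤) (h𝓓 : IsLowerSet 𝓓)
    (h𝓓'' : IsLowerSet 𝓓'') (h𝓤' : IsUpperSet 𝓤')
    (hζ : ζ ∈ outClass ends U h ξ) (hl : l ∉ U) {ω ω' : Config (arms ends ζ h)} (hω : ω ≤ ω')
    (hQ : orbitReal ends ζ h ω' ∈ gTypedQ ends l h 𝓤 𝓓 𝓓'' X 𝓤') :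
    orbitReal ends ζ h ω ∈ gTypedQ ends l h 𝓤 𝓓 𝓓'' X 𝓤' := by
  rw [orbitReal_eq_flip_of_le hω]
  have hD : ArmClosed ends (orbitReal ends ζ h ω') h
      {x | ∃ P : arms ends ζ h, (ω P = false ∧ ω' P = true) ∧ x ∈ P.1} :=
    armClosed_of_hull_eq (hull_orbitReal hc ω') (armClosed_armsSel _)
  refine flip_mem_gTypedQ_of_armClosed_red h𝓤 h𝓓 h𝓓'' h𝓤' (coreFree_orbitReal hc ω') hD ?_ ?_
    hl hQ
  · rintro x ⟨P, hP, hxP⟩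
    rw [cluster_orbitReal hc]
    refine ⟨(mem_hull_sdiff_of_mem_arms P.2 hxP).1, ?_⟩
    rintro ⟨Q, hQ, hxQ⟩
    have : Q = P := Subtype.ext (arms_eq_of_mem Q.2 P.2 hxQ hxP)
    subst this
    rw [hP.2] at hQ; exact absurd hQ (by decide)
  · rintro x ⟨P, _, hxP⟩
    exact (mem_outClass.1 hζ).2 (mem_hull_sdiff_of_mem_arms P.2 hxP).1

/-- **The rigid counting inequality on an orbit, general doubly typed side.** -/
theorem card_orbit_le_g (hloop : ∀ e, ends e ≠ s(h, h)) {U : Set V} {ξ : Config E} {l : V}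
    {𝓤 𝓓 𝓓'' : Set (Set V)} {X : Set V} {𝓤' : Set (Set V)} (h𝓤 : IsUpperSet 𝓤)
    (h𝓓 : IsLowerSet 𝓓) (h𝓓'' : IsLowerSet 𝓓'') (h𝓤' : IsUpperSet 𝓤')
    (hζ : ζ ∈ outClass ends U h ξ) (hl : l ∉ U) {𝓔 : Set (Set E)} (h𝓔 : IsUpperSet 𝓔) :
    ((orbit ends ζ h).filter fun ζ' =>
        ζ' ∈ gTypedQ ends l h 𝓤 𝓓 𝓓'' X 𝓤' ∧ redEdges ends ζ' h ∈ 𝓔).card ≤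
      ((orbit ends ζ h).filter fun ζ' =>
        ζ' ∈ gTypedQ ends l h 𝓤 𝓓 𝓓'' X 𝓤' ∧ blueEdges ends ζ' h ∈ 𝓔).card := by
  have key := card_le_of_cube_edges (ends := ends) (orbitReal ends ζ h) orbitReal_injective
    (orbit ends ζ h) (fun ζ' => by simp only [orbit, Finset.mem_image, Finset.mem_univ, true_and])
    (↑(gTypedQ ends l h 𝓤 𝓓 𝓓'' X 𝓤'))
    (fun ω' ω hω hQ => orbitReal_mem_gTypedQ_of_le hc h𝓤 h𝓓 h𝓓'' h𝓤' hζ hl hω hQ) h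
    (fun 𝓔' h𝓔' ω ω' hω hω𝓔 => h𝓔' (redEdges_orbitReal_mono hc hω) hω𝓔)
    (fun 𝓔' h𝓔' ω' ω hω hω𝓔 => h𝓔' (blueEdges_orbitReal_anti hc hloop hω) hω𝓔)
    (fun ω => blueEdges_orbitReal_flipAll hc hloop ω) h𝓔
  simpa only [Finset.mem_coe] using key

end OrbitCube

section Sum

variable {U : Set V} {ξ : Config E} {l h : V} {𝓤 𝓓 𝓓'' : Set (Set V)} {X : Set V}
  {𝓤' : Set (Set V)}

/-- **THE ARM PRINCIPLE, GENERAL DOUBLY TYPED SIDE**: the core-free part of every class satisfies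
the rigid counting inequality on `gTypedQ` (no loop at `h`). -/
theorem card_coreFree_le_g (h𝓤 : IsUpperSet 𝓤) (h𝓓 : IsLowerSet 𝓓) (h𝓓'' : IsLowerSet 𝓓'')
    (h𝓤' : IsUpperSet 𝓤') (hl : l ∉ U) (hloop : ∀ e, ends e ≠ s(h, h)) {𝓔 : Set (Set E)}
    (h𝓔 : IsUpperSet 𝓔) :
    ((gCoreFreePart ends l h 𝓤 𝓓 𝓓'' X 𝓤' U ξ).filter fun ζ => redEdges ends ζ h ∈ 𝓔).card ≤
      ((gCoreFreePart ends l h 𝓤 𝓓 𝓓'' X 𝓤' U ξ).filter fun ζ => blueEdges ends ζ h ∈ 𝓔).card := by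
  set C := gCoreFreePart ends l h 𝓤 𝓓 𝓓'' X 𝓤' U ξ with hC
  let can : Config E → Config E := fun ζ => allRed ends ζ h
  let S₀ : Finset (Config E) := C.image can
  have hmapR : ∀ ζ ∈ C.filter fun ζ => redEdges ends ζ h ∈ 𝓔, can ζ ∈ S₀ :=
    fun ζ hζ => Finset.mem_image_of_mem can (Finset.mem_filter.1 hζ).1
  have hmapB : ∀ ζ ∈ C.filter fun ζ => blueEdges ends ζ h ∈ 𝓔, can ζ ∈ S₀ :=
    fun ζ hζ => Finset.mem_image_of_mem can (Finset.mem_filter.1 hζ).1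
  rw [Finset.card_eq_sum_card_fiberwise hmapR, Finset.card_eq_sum_card_fiberwise hmapB]
  refine Finset.sum_le_sum fun ζ₀ hζ₀ => ?_
  obtain ⟨ζ₁, hζ₁, rfl⟩ := Finset.mem_image.1 hζ₀
  have hζ₁' := Finset.mem_filter.1 hζ₁
  have hc₁ : CoreFree ends ζ₁ h := hζ₁'.2
  have hcl₁ : ζ₁ ∈ outClass ends U h ξ := (mem_gOutSide.1 hζ₁'.1).2
  have hc₀ : CoreFree ends (allRed ends ζ₁ h) h := coreFree_allRed hc₁
  have hcl₀ : allRed ends ζ₁ h ∈ outClass ends U h ξ := allRed_mem_outClass hcl₁ hc₁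
  have hfib : ∀ P : Config E → Prop,
      (C.filter fun ζ => P ζ).filter (fun ζ => can ζ = can ζ₁) =
        (orbit ends (allRed ends ζ₁ h) h).filter fun ζ' =>
          ζ' ∈ gTypedQ ends l h 𝓤 𝓓 𝓓'' X 𝓤' ∧ P ζ' := by
    intro P
    ext ζ'
    simp only [hC, Finset.mem_filter, gCoreFreePart, orbit, Finset.mem_image, Finset.mem_univ,
      true_and, mem_gOutSide, can]
    constructor
    · rintro ⟨⟨⟨⟨hQ, _⟩, hc'⟩, hP⟩, hcan⟩
      obtain ⟨ω, hω⟩ := exists_orbitReal_eq hc' hcan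
      exact ⟨⟨ω, hω⟩, hQ, hP⟩
    · rintro ⟨⟨ω, rfl⟩, hQ, hP⟩
      refine ⟨⟨⟨⟨hQ, orbitReal_mem_outClass hc₀ hcl₀ ω⟩, coreFree_orbitReal hc₀ ω⟩, hP⟩, ?_⟩
      rw [allRed_orbitReal hc₀ ω, allRed_idem hc₁]
  rw [hfib, hfib]
  exact card_orbit_le_g hc₀ hloop h𝓤 h𝓓 h𝓓'' h𝓤' hcl₀ hl h𝓔

/-- **A class all of whose `gTypedQ`-configurations are core-free satisfies the rigid inequality
on the general doubly typed side.** -/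
theorem rigidOK_g_of_coreFree (h𝓤 : IsUpperSet 𝓤) (h𝓓 : IsLowerSet 𝓓) (h𝓓'' : IsLowerSet 𝓓'')
    (h𝓤' : IsUpperSet 𝓤') (hl : l ∉ U) (hloop : ∀ e, ends e ≠ s(h, h))
    (hcf : ∀ ζ ∈ gOutSide ends l h 𝓤 𝓓 𝓓'' X 𝓤' U ξ, CoreFree ends ζ h) {𝓔 : Set (Set E)}
    (h𝓔 : IsUpperSet 𝓔) :
    ((gOutSide ends l h 𝓤 𝓓 𝓓'' X 𝓤' U ξ).filter fun ζ => redEdges ends ζ h ∈ 𝓔).card ≤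
      ((gOutSide ends l h 𝓤 𝓓 𝓓'' X 𝓤' U ξ).filter fun ζ => blueEdges ends ζ h ∈ 𝓔).card := by
  have heq : gCoreFreePart ends l h 𝓤 𝓓 𝓓'' X 𝓤' U ξ = gOutSide ends l h 𝓤 𝓓 𝓓'' X 𝓤' U ξ := by
    ext ζ
    simp only [gCoreFreePart, Finset.mem_filter]
    exact ⟨fun h' => h'.1, fun h' => ⟨h', hcf ζ h'⟩⟩
  have := card_coreFree_le_g (ends := ends) (ξ := ξ) (X := X) h𝓤 h𝓓 h𝓓'' h𝓤' hl hloop h𝓔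
  rw [heq] at this
  exact this

/-- When every vertex of `U ∖ {h}` is forced into `C_R(l)` by `𝓤`, forced out of `C_R(h)` by
`𝓓″`, in `X`, has an outside edge, or has no edge at all, every `gTypedQ`-configuration of the
class is core-free. -/
theorem coreFree_of_outEdges_g
    (hout : ∀ x ∈ U, x ≠ h → (∀ S ∈ 𝓤, x ∈ S) ∨ (∀ S ∈ 𝓓'', x ∉ S) ∨ x ∈ X ∨
      (∃ e y, ends e = s(x, y) ∧ y ∉ U) ∨ (∀ e, x ∉ ends e))
    {ζ : Config E} (hζ : ζ ∈ gOutSide ends l h 𝓤 𝓓 𝓓'' X 𝓤' U ξ) : CoreFree ends ζ h := by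
  intro x hxT hxTp
  by_contra hxh
  have hQ := (mem_gOutSide.1 hζ).1
  have hcl := (mem_gOutSide.1 hζ).2
  rw [mem_gTypedQ] at hQ
  obtain ⟨hh, hA, -, hRh, hX, -⟩ := hQ
  have hhA : h ∉ cluster ends ζ l := fun h' => hh (Or.inl h')
  have hxU : x ∈ U := (mem_outClass.1 hcl).2 (Or.inl hxT)
  rcases hout x hxU hxh with hf | hf'' | hxX | ⟨e, y, hxy, hyU⟩ | hiso
  · exact hhA (conn_trans (hf _ hA) (conn_symm hxT))
  · exact hf'' _ hRh hxT
  · exact hX x hxX (Or.inl hxT)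
  · cases he : ζ e with
    | true => exact hyU ((mem_outClass.1 hcl).2 (Or.inl (mem_cluster_of_edge hxT he hxy)))
    | false =>
      have he' : blue ζ e = true := by rw [blue_eq_true_iff]; exact he
      exact hyU ((mem_outClass.1 hcl).2 (Or.inr (mem_cluster_of_edge hxTp he' hxy)))
  · obtain ⟨e, hxe⟩ := exists_edge_of_mem_cluster hxT hxh
    exact hiso e hxe

/-- **The rigid inequality on the general doubly typed side of every class of a region whose
vertices other than `h` are exempt, carry an outside edge, or carry no edge** (no loop at `h`). -/
theorem rigidOK_g_of_outEdges' (h𝓤 : IsUpperSet 𝓤) (h𝓓 : IsLowerSet 𝓓) (h𝓓'' : IsLowerSet 𝓓'')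
    (h𝓤' : IsUpperSet 𝓤') (hl : l ∉ U) (hloop : ∀ e, ends e ≠ s(h, h))
    (hout : ∀ x ∈ U, x ≠ h → (∀ S ∈ 𝓤, x ∈ S) ∨ (∀ S ∈ 𝓓'', x ∉ S) ∨ x ∈ X ∨
      (∃ e y, ends e = s(x, y) ∧ y ∉ U) ∨ (∀ e, x ∉ ends e))
    {𝓔 : Set (Set E)} (h𝓔 : IsUpperSet 𝓔) :
    ((gOutSide ends l h 𝓤 𝓓 𝓓'' X 𝓤' U ξ).filter fun ζ => redEdges ends ζ h ∈ 𝓔).card ≤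
      ((gOutSide ends l h 𝓤 𝓓 𝓓'' X 𝓤' U ξ).filter fun ζ => blueEdges ends ζ h ∈ 𝓔).card :=
  rigidOK_g_of_coreFree h𝓤 h𝓓 h𝓓'' h𝓤' hl hloop (fun _ hζ => coreFree_of_outEdges_g hout hζ) h𝓔

end Sum

section Graph

variable {l h : V} {𝓤 𝓓 𝓓'' : Set (Set V)} {X : Set V} {𝓤' : Set (Set V)}

/-- **Gluing the classes of the region `{l}ᶜ`** on the general doubly typed side. -/
theorem card_le_g_of_classes (hlh : l ≠ h)
    (hcls : ∀ ξ : Config E, ∀ 𝓔 : Set (Set E), IsUpperSet 𝓔 →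
      ((gOutSide ends l h 𝓤 𝓓 𝓓'' X 𝓤' ({l}ᶜ) ξ).filter fun ζ => redEdges ends ζ h ∈ 𝓔).card ≤
        ((gOutSide ends l h 𝓤 𝓓 𝓓'' X 𝓤' ({l}ᶜ) ξ).filter fun ζ => blueEdges ends ζ h ∈ 𝓔).card)
    (𝓔 : Set (Set E)) (h𝓔 : IsUpperSet 𝓔) :
    ((gTypedQ ends l h 𝓤 𝓓 𝓓'' X 𝓤').filter fun ζ => redEdges ends ζ h ∈ 𝓔).card ≤
      ((gTypedQ ends l h 𝓤 𝓓 𝓓'' X 𝓤').filter fun ζ => blueEdges ends ζ h ∈ 𝓔).card := by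
  have _hlh := hlh
  set T := gTypedQ ends l h 𝓤 𝓓 𝓓'' X 𝓤' with hT
  let can : Config E → Config E := outRep ends ({l}ᶜ)
  have hmapR : ∀ ζ ∈ T.filter fun ζ => redEdges ends ζ h ∈ 𝓔, can ζ ∈ T.image can :=
    fun ζ hζ => Finset.mem_image_of_mem can (Finset.mem_filter.1 hζ).1
  have hmapB : ∀ ζ ∈ T.filter fun ζ => blueEdges ends ζ h ∈ 𝓔, can ζ ∈ T.image can :=
    fun ζ hζ => Finset.mem_image_of_mem can (Finset.mem_filter.1 hζ).1
  rw [Finset.card_eq_sum_card_fiberwise hmapR, Finset.card_eq_sum_card_fiberwise hmapB]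
  refine Finset.sum_le_sum fun ξ hξ => ?_
  obtain ⟨ζ₀, -, rfl⟩ := Finset.mem_image.1 hξ
  have hidem : ∀ ζ : Config E, outRep ends ({l}ᶜ) (outRep ends ({l}ᶜ) ζ) = outRep ends ({l}ᶜ) ζ := by
    intro ζ; funext e; simp only [outRep]; split_ifs <;> rfl
  have hfib : ∀ P : Config E → Prop,
      (T.filter fun ζ => P ζ).filter (fun ζ => can ζ = can ζ₀) =
        (gOutSide ends l h 𝓤 𝓓 𝓓'' X 𝓤' ({l}ᶜ) (can ζ₀)).filter fun ζ => P ζ := by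
    intro P
    ext ζ
    simp only [Finset.mem_filter, mem_gOutSide, mem_outClass, hT]
    constructor
    · rintro ⟨⟨hζ, hP⟩, hcan⟩
      refine ⟨⟨hζ, ?_, ?_⟩, hP⟩
      · intro e he
        rw [← hcan]
        simp only [can, outRep, he, if_false]
      · intro x hx hxl
        simp only [Set.mem_singleton_iff] at hxl
        subst hxl
        exact l_notMem_hull_of_mem_gTypedQ hζ hx
    · rintro ⟨⟨hζ, hagree, -⟩, hP⟩
      refine ⟨⟨hζ, hP⟩, ?_⟩
      show outRep ends ({l}ᶜ) ζ = outRep ends ({l}ᶜ) ζ₀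
      rw [outRep_eq_of_agree (ends := ends) (U := {l}ᶜ) (ζ := outRep ends ({l}ᶜ) ζ₀) (ζ' := ζ) hagree,
        hidem]
  rw [hfib, hfib]
  exact hcls _ 𝓔 h𝓔

/-- **THE GENERAL DOUBLY TYPED ROW ON g10's CLASS**: every vertex other than `l, h` forced into
`C_R(l)` by `𝓤`, forced out of `C_R(h)` by `𝓓″`, in `X`, joined to `l`, or isolated (no loop at
`h`), for every admissible choice of the five conditions. -/
theorem gTypedSwAll_of_outEdges (hlh : l ≠ h) (hloop : ∀ e, ends e ≠ s(h, h))
    (h𝓤 : IsUpperSet 𝓤) (h𝓓 : IsLowerSet 𝓓) (h𝓓'' : IsLowerSet 𝓓'') (h𝓤' : IsUpperSet 𝓤')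
    (hout : ∀ x, x ≠ l → x ≠ h → (∀ S ∈ 𝓤, x ∈ S) ∨ (∀ S ∈ 𝓓'', x ∉ S) ∨ x ∈ X ∨
      (∃ e, ends e = s(x, l)) ∨ (∀ e, x ∉ ends e)) :
    GTypedSwAll ends l h 𝓤 𝓓 𝓓'' X 𝓤' := by
  refine exists_swAll_injection_of_card_le h _ (card_le_g_of_classes hlh fun ξ 𝓔 h𝓔 => ?_)
  refine rigidOK_g_of_outEdges' (ξ := ξ) h𝓤 h𝓓 h𝓓'' h𝓤' (by simp) hloop ?_ h𝓔
  intro x hx hxh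
  rcases hout x (by simpa using hx) hxh with hf | hf'' | hxX | ⟨e, he⟩ | hiso
  · exact Or.inl hf
  · exact Or.inr (Or.inl hf'')
  · exact Or.inr (Or.inr (Or.inl hxX))
  · exact Or.inr (Or.inr (Or.inr (Or.inl ⟨e, l, he, by simp⟩)))
  · exact Or.inr (Or.inr (Or.inr (Or.inr hiso)))

end Graph

end LocRows

end Summit.Ventures.PercRepro2
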